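import Literature.NumberTheory.Transcendental.NesterenkoEliminationProp47ValuesProofs
import Literature.NumberTheory.Transcendental.NesterenkoEliminationProp44Holds
import HarnessLib

/-!
# LNM 1752 Ch. 3 Proposition 4.7 (degree, height and value of an unmixed ideal) — the discharge `…prop_4_7_holds`

Topic `Literature/NumberTheory/Transcendental`. Proofs only (no definitions, no named facts). This
file discharges the named fact `NesterenkoPhilippon2001_ch3_prop_4_7` of
`NesterenkoEliminationFacts.lean` — Yu. V. Nesterenko's Proposition 4.7 in Nesterenko–Philippon
(eds.), LNM 1752 (2001), Ch. 3 §4, p. 39 (`K = ℚ`, `ν = 1`, archimedean absolute value, `𝒦 = ℂ`):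
for a homogeneous unmixed ideal `I ⊂ ℚ[x₀, …, x_m]` with `dim I = r − 1`, `1 ≤ r ≤ m`, reduced
primary decomposition `I = I₁ ∩ … ∩ I_s`, `𝔭_j = √I_j`, `k_j` the exponent of `I_j`, and
`ω̄ ∈ ℂ^{m+1} ∖ 0`,

1. `∑ k_j deg 𝔭_j = deg I`;
2. `∑ k_j h(𝔭_j) ≤ h(I) + m² deg I`;
3. `∑ k_j log |𝔭_j(ω̄)| ≤ log |I(ω̄)| + m³ deg I` (vendored in the exponentiated form
   `∏ |𝔭_j(ω̄)|^{k_j} ≤ |I(ω̄)| e^{m³ deg I}`).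

The book prints no proof ("See [Nes10, Proposition 1.2]"). The proof here is the composition of two
theorems of the tree:

* `NesterenkoPhilippon2001_ch3_prop_4_7_of_prop_4_4` (`NesterenkoEliminationProp47ValuesProofs.lean`)
  — Proposition 4.7 follows from Proposition 4.4 (`Ī(r)` is principal, generated by
  `∏ F_j^{k_j}`, `F_j` the irreducible associated forms of the `𝔭_j`, all block degrees equal):
  part 1) by comparing block degrees (`sum_primaryExponent_mul_ideg_eq`,
  `NesterenkoEliminationProp47Proofs.lean`), part 2) by Gelfond's inequality for the height of a
  product after dehomogenising one variable per block (`sum_primaryExponent_mul_iheight_le`,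
  `NesterenkoEliminationProp47HeightsProofs.lean`), part 3) by Gelfond's lemma over `ℂ` applied to
  `ϰ(F) = c ∏ ϰ(F_j)^{k_j}` and the trivial upper bound for `|∏ F_j^{k_j}|` (`prod_iabs_pow_le`);
* `NesterenkoPhilippon2001_ch3_prop_4_4_holds` (`NesterenkoEliminationProp44Holds.lean`) — the
  discharge of Proposition 4.4.

## References

* [NesterenkoPhilippon2001] Yu. V. Nesterenko, P. Philippon (eds.), *Introduction to Algebraic
  Independence Theory*, Lecture Notes in Math. 1752, Springer 2001, Ch. 3 (Yu. V. Nesterenko) §4,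
  Prop. 4.4 (p. 38), Prop. 4.7 (p. 39); PDF page = book page + 12.
* [Nes10] Yu. V. Nesterenko, *On the measure of algebraic independence of values of Ramanujan
  functions*, Proc. Steklov Inst. Math. 218 (1997) 294–331, Prop. 1.2 (the printed proof reference).
-/

namespace Literature.NumberTheory.Transcendental

namespace Nesterenko

/-- **LNM 1752 Ch. 3 Proposition 4.7** (`K = ℚ`, `ν = 1`), discharged: for a homogeneous unmixed
ideal `I ⊂ ℚ[x₀, …, x_m]` with `dim I = r − 1`, `1 ≤ r ≤ m`, reduced primary decomposition
`I = ⋂ I_j`, `𝔭_j = √I_j`, exponents `k_j`, and `ω̄ ∈ ℂ^{m+1} ∖ 0`: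
1) `∑ k_j deg 𝔭_j = deg I`; 2) `∑ k_j h(𝔭_j) ≤ h(I) + m² deg I`;
3) `∏ |𝔭_j(ω̄)|^{k_j} ≤ |I(ω̄)| e^{m³ deg I}`. Proof: Proposition 4.7 from Proposition 4.4
(`NesterenkoPhilippon2001_ch3_prop_4_7_of_prop_4_4`) and the discharge of Proposition 4.4
(`NesterenkoPhilippon2001_ch3_prop_4_4_holds`).
[cite: NesterenkoPhilippon2001, Ch. 3 Prop. 4.7 (p. 39)] -/
theorem NesterenkoPhilippon2001_ch3_prop_4_7_holds : NesterenkoPhilippon2001_ch3_prop_4_7 :=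
  NesterenkoPhilippon2001_ch3_prop_4_7_of_prop_4_4 NesterenkoPhilippon2001_ch3_prop_4_4_holds

end Nesterenko

end Literature.NumberTheory.Transcendental
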